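import Mathlib.LinearAlgebra.CrossProduct
import Literature.Analysis.FunctionSpaces.TorusTrigPoly

/-!
# Packet wavevectors: two short lattice vectors per momentum `q`

Helper file for stub S5 (`stub_balancedMenu`) of the line `farkas-split-menu` of crux
`MomentParity.CubicParityLoud` (stmt-AnomalousDissipation-11465). For every non-zero momentum
`q ∈ ℤ³` there are two lattice vectors `k₁, k₂` with `|kᵢ|² ≤ 2`, `|kᵢ + q| ≤ |q|` (so the
packet `(kᵢ, kᵢ + q)` stays in every frequency ball containing `q`, radius `≥ 2`), non-degenerate
(`kᵢ ≠ 0`, `kᵢ + q ≠ 0`, `2kᵢ + q ≠ 0`: the four packet frequencies `±kᵢ, ±(kᵢ + q)` are distinct)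
and INDEPENDENT: `det(k₁, q, k₂) = k₁ · (q × k₂) ≠ 0`, so that the two stress directions
`k₁ × q`, `k₂ × q` span `q^⊥`. Recipe: with `i` the first non-zero coordinate of `q` and
`s = sign qᵢ`, take `kᵢ = -s eᵢ (+ one more unit vector)`; pure case analysis.
-/

namespace Summit.AnomalousDissipation.AnomalousDissipation.Theorems.MomentParityCubicParityLoud

open Finset Matrix
open Literature.Analysis.FunctionSpaces

set_option linter.dupNamespace false

/-- The squared norm of an explicit lattice vector. [folklore] -/
theorem freqNormSq_vec3 (a b c : ℤ) :
    Torus.freqNormSq (![a, b, c] : Fin 3 → ℤ) = (a : ℝ) ^ 2 + (b : ℝ) ^ 2 + (c : ℝ) ^ 2 := by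
  simp [Torus.freqNormSq, Fin.sum_univ_three]

/-- Sum of explicit lattice vectors. [folklore] -/
theorem vec3_add (a b c d e f : ℤ) : (![a, b, c] : Fin 3 → ℤ) + ![d, e, f] = ![a + d, b + e, c + f] := by
  ext i; fin_cases i <;> rfl

/-- Doubling an explicit lattice vector. [folklore] -/
theorem two_smul_vec3 (a b c : ℤ) : (2 : ℕ) • (![a, b, c] : Fin 3 → ℤ) = ![2 * a, 2 * b, 2 * c] := by
  ext i; fin_cases i <;> simp [two_mul]

/-- An explicit lattice vector vanishes iff its three entries vanish. [folklore] -/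
theorem vec3_eq_zero_iff (a b c : ℤ) : (![a, b, c] : Fin 3 → ℤ) = 0 ↔ a = 0 ∧ b = 0 ∧ c = 0 := by
  constructor
  · intro h
    exact ⟨by simpa using congrFun h 0, by simpa using congrFun h 1, by simpa using congrFun h 2⟩
  · rintro ⟨rfl, rfl, rfl⟩
    ext i; fin_cases i <;> rfl

/-- The triple product `k₁ · (q × k₂)` of explicit lattice vectors. [folklore] -/
theorem vec3_dot_cross (a b c d e f g h i : ℤ) :
    (![a, b, c] : Fin 3 → ℤ) ⬝ᵥ crossProduct ![d, e, f] ![g, h, i] =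
      a * (e * i - f * h) + b * (f * g - d * i) + c * (d * h - e * g) := by
  rw [cross_apply]
  simp only [vec3_dotProduct, Fin.isValue, cons_val_zero, cons_val_one, cons_val_two, Nat.succ_eq_add_one,
    Nat.reduceAdd, tail_cons, head_cons, add_assoc]

/-- **The wavevector conditions are symmetric under `(q, k₁, k₂) ↦ (-q, -k₁, -k₂)`.** [folklore] -/
theorem packetWavevectors_neg {q k₁ k₂ : Fin 3 → ℤ}
    (h : (k₁ ≠ 0 ∧ k₁ + q ≠ 0 ∧ (2 : ℕ) • k₁ + q ≠ 0 ∧ Torus.freqNormSq k₁ ≤ 2 ∧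
        Torus.freqNormSq (k₁ + q) ≤ Torus.freqNormSq q) ∧
      (k₂ ≠ 0 ∧ k₂ + q ≠ 0 ∧ (2 : ℕ) • k₂ + q ≠ 0 ∧ Torus.freqNormSq k₂ ≤ 2 ∧
        Torus.freqNormSq (k₂ + q) ≤ Torus.freqNormSq q) ∧
      k₁ ⬝ᵥ crossProduct q k₂ ≠ 0) :
    ((-k₁) ≠ 0 ∧ (-k₁) + (-q) ≠ 0 ∧ (2 : ℕ) • (-k₁) + (-q) ≠ 0 ∧ Torus.freqNormSq (-k₁) ≤ 2 ∧
        Torus.freqNormSq ((-k₁) + (-q)) ≤ Torus.freqNormSq (-q)) ∧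
      ((-k₂) ≠ 0 ∧ (-k₂) + (-q) ≠ 0 ∧ (2 : ℕ) • (-k₂) + (-q) ≠ 0 ∧ Torus.freqNormSq (-k₂) ≤ 2 ∧
        Torus.freqNormSq ((-k₂) + (-q)) ≤ Torus.freqNormSq (-q)) ∧
      (-k₁) ⬝ᵥ crossProduct (-q) (-k₂) ≠ 0 := by
  obtain ⟨⟨h1, h2, h3, h4, h5⟩, ⟨h6, h7, h8, h9, h10⟩, h11⟩ := h
  have e1 : ∀ k : Fin 3 → ℤ, -k + -q = -(k + q) := fun k => by abel
  have e2 : ∀ k : Fin 3 → ℤ, (2 : ℕ) • -k + -q = -((2 : ℕ) • k + q) := fun k => by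
    rw [smul_neg]; abel
  refine ⟨⟨neg_ne_zero.2 h1, ?_, ?_, ?_, ?_⟩, ⟨neg_ne_zero.2 h6, ?_, ?_, ?_, ?_⟩, ?_⟩
  · rw [e1]; exact neg_ne_zero.2 h2
  · rw [e2]; exact neg_ne_zero.2 h3
  · rwa [Torus.freqNormSq_neg]
  · rwa [e1, Torus.freqNormSq_neg, Torus.freqNormSq_neg]
  · rw [e1]; exact neg_ne_zero.2 h7
  · rw [e2]; exact neg_ne_zero.2 h8
  · rwa [Torus.freqNormSq_neg]
  · rwa [e1, Torus.freqNormSq_neg, Torus.freqNormSq_neg]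
  · rw [LinearMap.map_neg₂, LinearMap.map_neg, neg_neg, neg_dotProduct]
    exact neg_ne_zero.2 h11

/-- Packet wavevectors when the first coordinate of `q` is positive. [folklore] -/
theorem exists_packetWavevectors_pos₀ (a b c : ℤ) (ha : 0 < a) :
    ∃ k₁ k₂ : Fin 3 → ℤ,
      (k₁ ≠ 0 ∧ k₁ + ![a, b, c] ≠ 0 ∧ (2 : ℕ) • k₁ + ![a, b, c] ≠ 0 ∧ Torus.freqNormSq k₁ ≤ 2 ∧
          Torus.freqNormSq (k₁ + ![a, b, c]) ≤ Torus.freqNormSq (![a, b, c] : Fin 3 → ℤ)) ∧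
        (k₂ ≠ 0 ∧ k₂ + ![a, b, c] ≠ 0 ∧ (2 : ℕ) • k₂ + ![a, b, c] ≠ 0 ∧ Torus.freqNormSq k₂ ≤ 2 ∧
          Torus.freqNormSq (k₂ + ![a, b, c]) ≤ Torus.freqNormSq (![a, b, c] : Fin 3 → ℤ)) ∧
        k₁ ⬝ᵥ crossProduct ![a, b, c] k₂ ≠ 0 := by
  have ha' : (1 : ℝ) ≤ a := by exact_mod_cast ha
  by_cases hb : b = 0
  · subst hb
    by_cases hc : c = 0
    · subst hc
      -- axis case: `q = a e₀`, `k₁ = e₁ - e₀`, `k₂ = e₂ - e₀`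
      refine ⟨![-1, 1, 0], ![-1, 0, 1], ⟨by decide, ?_, ?_, ?_, ?_⟩, ⟨by decide, ?_, ?_, ?_, ?_⟩, ?_⟩
      · rw [vec3_add, Ne, vec3_eq_zero_iff]; omega
      · rw [two_smul_vec3, vec3_add, Ne, vec3_eq_zero_iff]; omega
      · rw [freqNormSq_vec3]; norm_num
      · rw [vec3_add, freqNormSq_vec3, freqNormSq_vec3]; push_cast; nlinarith
      · rw [vec3_add, Ne, vec3_eq_zero_iff]; omega
      · rw [two_smul_vec3, vec3_add, Ne, vec3_eq_zero_iff]; omega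
      · rw [freqNormSq_vec3]; norm_num
      · rw [vec3_add, freqNormSq_vec3, freqNormSq_vec3]; push_cast; nlinarith
      · rw [vec3_dot_cross]; omega
    · -- `q = (a, 0, c)`, `c ≠ 0`: `k₁ = -e₀`, `k₂ = -e₀ + e₁`
      have hc2 : (0 : ℝ) < (c : ℝ) ^ 2 := sq_pos_iff.mpr (by exact_mod_cast hc)
      refine ⟨![-1, 0, 0], ![-1, 1, 0], ⟨by decide, ?_, ?_, ?_, ?_⟩, ⟨by decide, ?_, ?_, ?_, ?_⟩, ?_⟩
      · rw [vec3_add, Ne, vec3_eq_zero_iff]; omega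
      · rw [two_smul_vec3, vec3_add, Ne, vec3_eq_zero_iff]; omega
      · rw [freqNormSq_vec3]; norm_num
      · rw [vec3_add, freqNormSq_vec3, freqNormSq_vec3]; push_cast; nlinarith
      · rw [vec3_add, Ne, vec3_eq_zero_iff]; omega
      · rw [two_smul_vec3, vec3_add, Ne, vec3_eq_zero_iff]; omega
      · rw [freqNormSq_vec3]; norm_num
      · rw [vec3_add, freqNormSq_vec3, freqNormSq_vec3]; push_cast; nlinarith
      · rw [vec3_dot_cross]; omega
  · by_cases hc : c = 0
    · subst hc
      -- `q = (a, b, 0)`, `b ≠ 0`: `k₁ = -e₀`, `k₂ = -e₀ + e₂`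
      have hb2 : (0 : ℝ) < (b : ℝ) ^ 2 := sq_pos_iff.mpr (by exact_mod_cast hb)
      refine ⟨![-1, 0, 0], ![-1, 0, 1], ⟨by decide, ?_, ?_, ?_, ?_⟩, ⟨by decide, ?_, ?_, ?_, ?_⟩, ?_⟩
      · rw [vec3_add, Ne, vec3_eq_zero_iff]; omega
      · rw [two_smul_vec3, vec3_add, Ne, vec3_eq_zero_iff]; omega
      · rw [freqNormSq_vec3]; norm_num
      · rw [vec3_add, freqNormSq_vec3, freqNormSq_vec3]; push_cast; nlinarith
      · rw [vec3_add, Ne, vec3_eq_zero_iff]; omega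
      · rw [two_smul_vec3, vec3_add, Ne, vec3_eq_zero_iff]; omega
      · rw [freqNormSq_vec3]; norm_num
      · rw [vec3_add, freqNormSq_vec3, freqNormSq_vec3]; push_cast; nlinarith
      · rw [vec3_dot_cross]; omega
    · -- `q = (a, b, c)`, `b, c ≠ 0`: `k₁ = -e₀`, `k₂ = -e₀ - sign(b) e₁`
      have hc2 : (0 : ℝ) < (c : ℝ) ^ 2 := sq_pos_iff.mpr (by exact_mod_cast hc)
      rcases lt_or_gt_of_ne hb with hbn | hbp
      · have hb' : (b : ℝ) ≤ -1 := by exact_mod_cast (show b ≤ -1 by omega)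
        refine ⟨![-1, 0, 0], ![-1, 1, 0], ⟨by decide, ?_, ?_, ?_, ?_⟩, ⟨by decide, ?_, ?_, ?_, ?_⟩, ?_⟩
        · rw [vec3_add, Ne, vec3_eq_zero_iff]; omega
        · rw [two_smul_vec3, vec3_add, Ne, vec3_eq_zero_iff]; omega
        · rw [freqNormSq_vec3]; norm_num
        · rw [vec3_add, freqNormSq_vec3, freqNormSq_vec3]; push_cast; nlinarith
        · rw [vec3_add, Ne, vec3_eq_zero_iff]; omega
        · rw [two_smul_vec3, vec3_add, Ne, vec3_eq_zero_iff]; omega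
        · rw [freqNormSq_vec3]; norm_num
        · rw [vec3_add, freqNormSq_vec3, freqNormSq_vec3]; push_cast; nlinarith
        · rw [vec3_dot_cross]; omega
      · have hb' : (1 : ℝ) ≤ b := by exact_mod_cast hbp
        refine ⟨![-1, 0, 0], ![-1, -1, 0], ⟨by decide, ?_, ?_, ?_, ?_⟩, ⟨by decide, ?_, ?_, ?_, ?_⟩, ?_⟩
        · rw [vec3_add, Ne, vec3_eq_zero_iff]; omega
        · rw [two_smul_vec3, vec3_add, Ne, vec3_eq_zero_iff]; omega
        · rw [freqNormSq_vec3]; norm_num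
        · rw [vec3_add, freqNormSq_vec3, freqNormSq_vec3]; push_cast; nlinarith
        · rw [vec3_add, Ne, vec3_eq_zero_iff]; omega
        · rw [two_smul_vec3, vec3_add, Ne, vec3_eq_zero_iff]; omega
        · rw [freqNormSq_vec3]; norm_num
        · rw [vec3_add, freqNormSq_vec3, freqNormSq_vec3]; push_cast; nlinarith
        · rw [vec3_dot_cross]; omega

/-- Packet wavevectors when `q = (0, b, c)` with `b > 0`. [folklore] -/
theorem exists_packetWavevectors_pos₁ (b c : ℤ) (hb : 0 < b) :
    ∃ k₁ k₂ : Fin 3 → ℤ,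
      (k₁ ≠ 0 ∧ k₁ + ![0, b, c] ≠ 0 ∧ (2 : ℕ) • k₁ + ![0, b, c] ≠ 0 ∧ Torus.freqNormSq k₁ ≤ 2 ∧
          Torus.freqNormSq (k₁ + ![0, b, c]) ≤ Torus.freqNormSq (![0, b, c] : Fin 3 → ℤ)) ∧
        (k₂ ≠ 0 ∧ k₂ + ![0, b, c] ≠ 0 ∧ (2 : ℕ) • k₂ + ![0, b, c] ≠ 0 ∧ Torus.freqNormSq k₂ ≤ 2 ∧
          Torus.freqNormSq (k₂ + ![0, b, c]) ≤ Torus.freqNormSq (![0, b, c] : Fin 3 → ℤ)) ∧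
        k₁ ⬝ᵥ crossProduct ![0, b, c] k₂ ≠ 0 := by
  have hb' : (1 : ℝ) ≤ b := by exact_mod_cast hb
  by_cases hc : c = 0
  · subst hc
    -- axis case: `q = b e₁`, `k₁ = e₀ - e₁`, `k₂ = e₂ - e₁`
    refine ⟨![1, -1, 0], ![0, -1, 1], ⟨by decide, ?_, ?_, ?_, ?_⟩, ⟨by decide, ?_, ?_, ?_, ?_⟩, ?_⟩
    · rw [vec3_add, Ne, vec3_eq_zero_iff]; omega
    · rw [two_smul_vec3, vec3_add, Ne, vec3_eq_zero_iff]; omega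
    · rw [freqNormSq_vec3]; norm_num
    · rw [vec3_add, freqNormSq_vec3, freqNormSq_vec3]; push_cast; nlinarith
    · rw [vec3_add, Ne, vec3_eq_zero_iff]; omega
    · rw [two_smul_vec3, vec3_add, Ne, vec3_eq_zero_iff]; omega
    · rw [freqNormSq_vec3]; norm_num
    · rw [vec3_add, freqNormSq_vec3, freqNormSq_vec3]; push_cast; nlinarith
    · rw [vec3_dot_cross]; omega
  · -- `q = (0, b, c)`, `c ≠ 0`: `k₁ = -e₁`, `k₂ = -e₁ + e₀`
    have hc2 : (0 : ℝ) < (c : ℝ) ^ 2 := sq_pos_iff.mpr (by exact_mod_cast hc)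
    refine ⟨![0, -1, 0], ![1, -1, 0], ⟨by decide, ?_, ?_, ?_, ?_⟩, ⟨by decide, ?_, ?_, ?_, ?_⟩, ?_⟩
    · rw [vec3_add, Ne, vec3_eq_zero_iff]; omega
    · rw [two_smul_vec3, vec3_add, Ne, vec3_eq_zero_iff]; omega
    · rw [freqNormSq_vec3]; norm_num
    · rw [vec3_add, freqNormSq_vec3, freqNormSq_vec3]; push_cast; nlinarith
    · rw [vec3_add, Ne, vec3_eq_zero_iff]; omega
    · rw [two_smul_vec3, vec3_add, Ne, vec3_eq_zero_iff]; omega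
    · rw [freqNormSq_vec3]; norm_num
    · rw [vec3_add, freqNormSq_vec3, freqNormSq_vec3]; push_cast; nlinarith
    · rw [vec3_dot_cross]; omega

/-- Packet wavevectors when `q = (0, 0, c)` with `c > 0`. [folklore] -/
theorem exists_packetWavevectors_pos₂ (c : ℤ) (hc : 0 < c) :
    ∃ k₁ k₂ : Fin 3 → ℤ,
      (k₁ ≠ 0 ∧ k₁ + ![0, 0, c] ≠ 0 ∧ (2 : ℕ) • k₁ + ![0, 0, c] ≠ 0 ∧ Torus.freqNormSq k₁ ≤ 2 ∧
          Torus.freqNormSq (k₁ + ![0, 0, c]) ≤ Torus.freqNormSq (![0, 0, c] : Fin 3 → ℤ)) ∧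
        (k₂ ≠ 0 ∧ k₂ + ![0, 0, c] ≠ 0 ∧ (2 : ℕ) • k₂ + ![0, 0, c] ≠ 0 ∧ Torus.freqNormSq k₂ ≤ 2 ∧
          Torus.freqNormSq (k₂ + ![0, 0, c]) ≤ Torus.freqNormSq (![0, 0, c] : Fin 3 → ℤ)) ∧
        k₁ ⬝ᵥ crossProduct ![0, 0, c] k₂ ≠ 0 := by
  have hc' : (1 : ℝ) ≤ c := by exact_mod_cast hc
  -- axis case: `q = c e₂`, `k₁ = e₀ - e₂`, `k₂ = e₁ - e₂`
  refine ⟨![1, 0, -1], ![0, 1, -1], ⟨by decide, ?_, ?_, ?_, ?_⟩, ⟨by decide, ?_, ?_, ?_, ?_⟩, ?_⟩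
  · rw [vec3_add, Ne, vec3_eq_zero_iff]; omega
  · rw [two_smul_vec3, vec3_add, Ne, vec3_eq_zero_iff]; omega
  · rw [freqNormSq_vec3]; norm_num
  · rw [vec3_add, freqNormSq_vec3, freqNormSq_vec3]; push_cast; nlinarith
  · rw [vec3_add, Ne, vec3_eq_zero_iff]; omega
  · rw [two_smul_vec3, vec3_add, Ne, vec3_eq_zero_iff]; omega
  · rw [freqNormSq_vec3]; norm_num
  · rw [vec3_add, freqNormSq_vec3, freqNormSq_vec3]; push_cast; nlinarith
  · rw [vec3_dot_cross]; omega

/-- **PACKET WAVEVECTORS**: for every non-zero momentum `q ∈ ℤ³` there are lattice vectors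
`k₁, k₂` with `kᵢ ≠ 0`, `kᵢ + q ≠ 0`, `2kᵢ + q ≠ 0`, `|kᵢ|² ≤ 2`, `|kᵢ + q|² ≤ |q|²`, and
`k₁ · (q × k₂) ≠ 0`. [folklore] -/
theorem exists_packetWavevectors (q : Fin 3 → ℤ) (hq : q ≠ 0) :
    ∃ k₁ k₂ : Fin 3 → ℤ,
      (k₁ ≠ 0 ∧ k₁ + q ≠ 0 ∧ (2 : ℕ) • k₁ + q ≠ 0 ∧ Torus.freqNormSq k₁ ≤ 2 ∧
          Torus.freqNormSq (k₁ + q) ≤ Torus.freqNormSq q) ∧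
        (k₂ ≠ 0 ∧ k₂ + q ≠ 0 ∧ (2 : ℕ) • k₂ + q ≠ 0 ∧ Torus.freqNormSq k₂ ≤ 2 ∧
          Torus.freqNormSq (k₂ + q) ≤ Torus.freqNormSq q) ∧
        k₁ ⬝ᵥ crossProduct q k₂ ≠ 0 := by
  -- reduce to the sign-normalised cases through the symmetry `q ↦ -q`
  have key : ∀ q : Fin 3 → ℤ, (0 < q 0 ∨ (q 0 = 0 ∧ 0 < q 1) ∨ (q 0 = 0 ∧ q 1 = 0 ∧ 0 < q 2)) →
      ∃ k₁ k₂ : Fin 3 → ℤ,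
        (k₁ ≠ 0 ∧ k₁ + q ≠ 0 ∧ (2 : ℕ) • k₁ + q ≠ 0 ∧ Torus.freqNormSq k₁ ≤ 2 ∧
            Torus.freqNormSq (k₁ + q) ≤ Torus.freqNormSq q) ∧
          (k₂ ≠ 0 ∧ k₂ + q ≠ 0 ∧ (2 : ℕ) • k₂ + q ≠ 0 ∧ Torus.freqNormSq k₂ ≤ 2 ∧
            Torus.freqNormSq (k₂ + q) ≤ Torus.freqNormSq q) ∧
          k₁ ⬝ᵥ crossProduct q k₂ ≠ 0 := by
    intro q hq
    have hq3 : q = ![q 0, q 1, q 2] := by ext i; fin_cases i <;> rfl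
    rcases hq with h0 | ⟨h0, h1⟩ | ⟨h0, h1, h2⟩
    · rw [hq3]; exact exists_packetWavevectors_pos₀ _ _ _ h0
    · rw [hq3, h0]; exact exists_packetWavevectors_pos₁ _ _ h1
    · rw [hq3, h0, h1]; exact exists_packetWavevectors_pos₂ _ h2
  have hneg : ∀ q : Fin 3 → ℤ, (∃ k₁ k₂ : Fin 3 → ℤ,
        (k₁ ≠ 0 ∧ k₁ + (-q) ≠ 0 ∧ (2 : ℕ) • k₁ + (-q) ≠ 0 ∧ Torus.freqNormSq k₁ ≤ 2 ∧
            Torus.freqNormSq (k₁ + (-q)) ≤ Torus.freqNormSq (-q)) ∧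
          (k₂ ≠ 0 ∧ k₂ + (-q) ≠ 0 ∧ (2 : ℕ) • k₂ + (-q) ≠ 0 ∧ Torus.freqNormSq k₂ ≤ 2 ∧
            Torus.freqNormSq (k₂ + (-q)) ≤ Torus.freqNormSq (-q)) ∧
          k₁ ⬝ᵥ crossProduct (-q) k₂ ≠ 0) →
      ∃ k₁ k₂ : Fin 3 → ℤ,
        (k₁ ≠ 0 ∧ k₁ + q ≠ 0 ∧ (2 : ℕ) • k₁ + q ≠ 0 ∧ Torus.freqNormSq k₁ ≤ 2 ∧
            Torus.freqNormSq (k₁ + q) ≤ Torus.freqNormSq q) ∧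
          (k₂ ≠ 0 ∧ k₂ + q ≠ 0 ∧ (2 : ℕ) • k₂ + q ≠ 0 ∧ Torus.freqNormSq k₂ ≤ 2 ∧
            Torus.freqNormSq (k₂ + q) ≤ Torus.freqNormSq q) ∧
          k₁ ⬝ᵥ crossProduct q k₂ ≠ 0 := by
    rintro q ⟨k₁, k₂, h⟩
    refine ⟨-k₁, -k₂, ?_⟩
    have := packetWavevectors_neg h
    rwa [neg_neg] at this
  by_cases h0 : q 0 = 0
  · by_cases h1 : q 1 = 0
    · have h2 : q 2 ≠ 0 := by
        intro h2; apply hq; ext i; fin_cases i <;> assumption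
      rcases lt_or_gt_of_ne h2 with hn | hp
      · exact hneg q (key (-q) (Or.inr (Or.inr ⟨by simp [h0], by simp [h1], by simp; omega⟩)))
      · exact key q (Or.inr (Or.inr ⟨h0, h1, hp⟩))
    · rcases lt_or_gt_of_ne h1 with hn | hp
      · exact hneg q (key (-q) (Or.inr (Or.inl ⟨by simp [h0], by simp; omega⟩)))
      · exact key q (Or.inr (Or.inl ⟨h0, hp⟩))
  · rcases lt_or_gt_of_ne h0 with hn | hp
    · exact hneg q (key (-q) (Or.inl (by simp; omega)))
    · exact key q (Or.inl hp)

/-- **Registered sub-goal `balancedMenu_packetWavevectors` of stub S5 `stub_balancedMenu`** (summary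
of this file): two short independent packet wavevectors per non-zero momentum. [folklore] -/
theorem balancedMenu_packetWavevectors : ∀ q : Fin 3 → ℤ, q ≠ 0 → ∃ k₁ k₂ : Fin 3 → ℤ, (k₁ ≠ 0 ∧ k₁ + q ≠ 0 ∧ (2 : ℕ) • k₁ + q ≠ 0 ∧ Torus.freqNormSq k₁ ≤ 2 ∧ Torus.freqNormSq (k₁ + q) ≤ Torus.freqNormSq q) ∧ (k₂ ≠ 0 ∧ k₂ + q ≠ 0 ∧ (2 : ℕ) • k₂ + q ≠ 0 ∧ Torus.freqNormSq k₂ ≤ 2 ∧ Torus.freqNormSq (k₂ + q) ≤ Torus.freqNormSq q) ∧ k₁ ⬝ᵥ crossProduct q k₂ ≠ 0 :=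
  exists_packetWavevectors

end Summit.AnomalousDissipation.AnomalousDissipation.Theorems.MomentParityCubicParityLoud
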